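import Literature.Probability.LatticeModels.DoubleCurrentsProofs
import Literature.Probability.LatticeModels.PlusFreeComparison
import HarnessLib

/-!
# The periodic two-point function converges to the infinite-volume two-point function

Topic `Literature/Probability/LatticeModels`; family `crit-ising`. Theorem-only file (no definition,
no named fact, no sorry).

## What is proved

For the nearest-neighbour ferromagnetic Ising model on `ℤ^d` at `β ≥ 0`, zero field, and the
periodic models on the tori `(ℤ/Nℤ)^d` (`isingTorusTwoPoint`):

* `isingTorusTwoPoint_le_isingCorr_plus_box` — **torus ≤ plus box**: for `x, y ∈ Λ_M`, `x ≠ y`,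
  and `2M + 4 ≤ N`, `⟨σ_{x̄}σ_{ȳ}⟩_{𝕋_N;β} ≤ ⟨σ_xσ_y⟩⁺_{Λ_M;β}` (freezing to `+1` the spins of the
  torus outside the image of `Λ_M` raises correlations, Griffiths' second inequality in the form
  `isingCorr_plus_le_of_subset`; the frozen torus is the `+` box, transported along the
  embedding — `isingCorr_plus_map` of `TorusZeroMode`);
* together with the tree's **free box ≤ torus** (`isingTwoPoint_free_box_le_torus_of_gks`, fed
  with `GKSInequalities.gks_two_holds`), the sandwich
  `⟨σ_xσ_y⟩^∅_{Λ_n} ≤ ⟨σ_{x̄}σ_{ȳ}⟩_{𝕋_N} ≤ ⟨σ_xσ_y⟩⁺_{Λ_M}`;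
* `abs_isingTorusTwoPoint_sub_plusCorr_le` — **convergence**: if the free and plus states agree
  on `σ_xσ_y` (e.g. whenever `m*(β) = 0`, `freeCorr_eq_plusCorr_of_spontaneousMagnetization_eq_zero`
  of `PlusFreeComparison`: all `β < β_c`, and `β = β_c` in `d ≥ 3`), then
  `⟨σ_{x̄}σ_{ȳ}⟩_{𝕋_N;β} → ⟨σ_xσ_y⟩_β` as `N → ∞` (`ε`–`N₀` form, all `N ≥ N₀`), and the
  specialisation `abs_isingTorusTwoPoint_sub_plusCorr_le_of_spontaneousMagnetization_eq_zero`.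

This is Aizenman–Duminil-Copin 2021, **Proposition 5.2, second item** (arXiv:1912.07973, p. 17:
"the correlation functions of that state satisfy, for any finite `A ⊂ ℤ^d` and any sequence of
finite volumes `V_n` which asymptotically cover any finite region, `⟨∏τ⟩_{ρ,β} = lim ⟨∏τ⟩^{(b.c.)}_{V_n}`
with boundary conditions which may include cross-boundary spin couplings (e.g. periodic)";
"The statement follows by standard arguments that we omit here. The main ingredients are …
the FKG inequality") for pair correlations and the periodic boxes, proved here by the Griffiths
sandwich (no exponential decay is needed for this item). It is the link between the torus, where
reflection positivity gives the infrared bound (`infraredBound_holds`) and the transfer matrix gives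
the monotonicity of `Ĝ` (`TorusTransferSpectral`), and the infinite-volume two-point function of
ADC §5 (step V2 of the tree's programme towards ADC Thm 5.6,
`aizenmanDuminilCopin_slidingScaleInfraredBound`).

## References

* M. Aizenman, H. Duminil-Copin, Ann. of Math. 194 (2021) = arXiv:1912.07973, Prop. 5.2 (p. 17)
  [AizenmanDuminilCopinAnnals2021].
* R. B. Griffiths, J. Math. Phys. 8 (1967) 478, 484; S. Friedli, Y. Velenik, *Statistical Mechanics
  of Lattice Systems* (2017), Exercise 3.12, Lemma 3.22, Exercise 3.31 [FriedliVelenik2017].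

## Mathlib

`Function.extend` (through `SpinConfig.extendAlong` of `IsingTransport`), `Finset.map`, `Sym2.map`,
`Fintype.sum_equiv`; no new Mathlib-level notion.
-/

noncomputable section

open MeasureTheory Filter Topology Finset

namespace Literature.Probability.LatticeModels

/-! ### Part 1. Plus = free on the whole vertex set -/

section PlusTransport

variable {V V' : Type*} {G : SimpleGraph V} {G' : SimpleGraph V'} [DecidableEq V] [DecidableEq V']
  [G.LocallyFinite] [G'.LocallyFinite]

/-- On the whole (finite) vertex set the plus and the free measures coincide (no outside spins,
`ℰ^b_V = ℰ_V`). [folklore] -/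
theorem isingMeasure_univ_plus_eq_free [Fintype V] (β h : ℝ) :
    isingMeasure G Finset.univ β h .plus = isingMeasure G Finset.univ β h .free := by
  have hglue : ∀ τ : ↥(Finset.univ : Finset V) → ℤˣ, glue Finset.univ τ (.plus : BoundaryCondition V) =
      glue Finset.univ τ .free := fun τ => by
    funext x
    rw [glue_apply_of_mem _ _ _ (Finset.mem_univ x), glue_apply_of_mem _ _ _ (Finset.mem_univ x)]
  have hE : edgesTouching G (Finset.univ : Finset V) = edgesIn G Finset.univ := by
    ext e
    rw [mem_edgesTouching_iff, mem_edgesIn_iff]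
    constructor
    · rintro ⟨he, -⟩
      exact ⟨he, fun x _ => Finset.mem_univ x⟩
    · rintro ⟨he, -⟩
      induction e using Sym2.ind with
      | _ a b => exact ⟨he, a, Finset.mem_univ a, Sym2.mem_mk_left _ _⟩
  have hH : ∀ σ : SpinConfig V, isingHamiltonian G Finset.univ h .plus σ =
      isingHamiltonian G Finset.univ h .free σ := fun σ => by
    simp only [isingHamiltonian, BoundaryCondition.plus, interactionEdges_fixed, interactionEdges_free, hE]
  have href : isingRef (Finset.univ : Finset V) (.plus : BoundaryCondition V) = isingRef Finset.univ .free := by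
    simp only [isingRef, hglue]
  rw [isingMeasure, isingMeasure, href]
  simp only [hH]

/-- `⟨σ_A⟩⁺_{V;β,h} = ⟨σ_A⟩^∅_{V;β,h}` on the whole finite vertex set. [folklore] -/
theorem isingCorr_univ_plus_eq_free [Fintype V] (β h : ℝ) (A : Finset V) :
    isingCorr G Finset.univ β h .plus A = isingCorr G Finset.univ β h .free A := by
  simp only [isingCorr, isingExpect, isingMeasure_univ_plus_eq_free]

end PlusTransport

/-! ### Part 2. Torus ≤ plus box -/

section Torus

variable {d : ℕ}

/-- The torus neighbours of the image of `x ∈ ℤ^d` are the images of its `ℤ^d`-neighbours (any `N`;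
`proj` is additive). [folklore] -/
theorem torusGraph_adj_proj_left_iff (N : ℕ) (x : Site d) (y' : TorusSite d N) :
    (torusGraph d N).Adj (Torus.proj N x) y' ↔
      Torus.proj N x ≠ y' ∧ ∃ y, Torus.proj N y = y' ∧ (zdGraph d).Adj x y := by
  rw [torusGraph_adj_iff]
  refine and_congr_right fun hne => ?_
  constructor
  · rintro (⟨i, rfl⟩ | ⟨i, h⟩)
    · exact ⟨x + Pi.single i 1, by rw [torusProj_add, torusProj_single],
        (zdGraph_adj_iff _ _).2 ⟨i, Or.inl rfl⟩⟩
    · refine ⟨x - Pi.single i 1, ?_, (zdGraph_adj_iff _ _).2 ⟨i, Or.inr (by simp)⟩⟩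
      rw [torusProj_sub, torusProj_single, h, add_sub_cancel_right]
  · rintro ⟨y, rfl, hxy⟩
    obtain ⟨i, h | h⟩ := (zdGraph_adj_iff _ _).1 hxy
    · exact Or.inl ⟨i, by rw [h, torusProj_add, torusProj_single]⟩
    · exact Or.inr ⟨i, by rw [h, torusProj_add, torusProj_single]⟩

/-- **Torus ≤ plus box** (Griffiths 1967; Friedli–Velenik 2017, Exercise 3.12 / Lemma 3.22: freezing
spins to `+1` raises correlations; Aizenman–Duminil-Copin 2021, Prop. 5.2, the comparison of
boundary conditions behind "standard arguments"): for `β ≥ 0`, zero field, `A ⊆ Λ_M` and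
`2M + 4 ≤ N`, `⟨σ_{Ā}⟩_{𝕋_N;β} ≤ ⟨σ_A⟩⁺_{Λ_M;β}` (`Ā` the image of `A` in the torus). Proof: in the
torus, `univ`-plus is the periodic measure (`isingCorr_univ_plus_eq_free`); shrinking the `+` volume
from the whole torus to the image of `Λ_M` raises correlations (`isingCorr_plus_le_of_subset`); the
`+` model on the image of `Λ_M` inside the torus is the `+` box, transported along the embedding of
`Λ_{M+1}` (injective for `2(M+1) < N`, a local isomorphism at `Λ_M`, `isingCorr_plus_map` twice).
[cite: FriedliVelenik2017, Exercise 3.12, p. 112] [cite: AizenmanDuminilCopinAnnals2021, arXiv:1912.07973 Prop. 5.2 (p. 17)] -/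
theorem isingCorr_torus_le_isingCorr_plus_box {β : ℝ} (hβ : 0 ≤ β) {M N : ℕ} [NeZero N]
    (hMN : 2 * M + 4 ≤ N) {A : Finset (Site d)} (hA : A ⊆ box d M) :
    isingCorr (torusGraph d N) Finset.univ β 0 .free (A.image (Torus.proj N)) ≤
      isingCorr (zdGraph d) (box d M) β 0 .plus A := by
  classical
  -- the frame `S = Λ_{M+1}` as a vertex type, its two embeddings
  set S := ↥(box d (M + 1)) with hS
  let ι₁ : S ↪ Site d := Function.Embedding.subtype _
  let Gs : SimpleGraph S := (zdGraph d).comap ι₁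
  let ι₂ : S ↪ TorusSite d N :=
    ⟨fun a => Torus.proj N a.1, fun a b hab =>
      Subtype.ext (torusProj_injOn_box (by omega) a.2 b.2 hab)⟩
  have hMM : box d M ⊆ box d (M + 1) := box_mono d (Nat.le_succ M)
  -- `Λ_M` and `A` inside `S`
  set Λ₀ : Finset S := Finset.univ.filter fun a => (a : Site d) ∈ box d M with hΛ₀
  set A₀ : Finset S := Finset.univ.filter fun a => (a : Site d) ∈ A with hA₀
  have hΛ₀map : Λ₀.map ι₁ = box d M := by
    ext x
    simp only [Finset.mem_map, Finset.mem_filter, Finset.mem_univ, true_and, hΛ₀]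
    constructor
    · rintro ⟨a, ha, rfl⟩; exact ha
    · intro hx; exact ⟨⟨x, hMM hx⟩, hx, rfl⟩
  have hA₀map : A₀.map ι₁ = A := by
    ext x
    simp only [Finset.mem_map, Finset.mem_filter, Finset.mem_univ, true_and, hA₀]
    constructor
    · rintro ⟨a, ha, rfl⟩; exact ha
    · intro hx; exact ⟨⟨x, hMM (hA hx)⟩, hx, rfl⟩
  have hA₀map₂ : A₀.map ι₂ = A.image (Torus.proj N) := by
    ext x'
    simp only [Finset.mem_map, Finset.mem_filter, Finset.mem_univ, true_and, hA₀, Finset.mem_image]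
    constructor
    · rintro ⟨a, ha, rfl⟩; exact ⟨a, ha, rfl⟩
    · rintro ⟨x, hx, rfl⟩; exact ⟨⟨x, hMM (hA hx)⟩, hx, rfl⟩
  have hA₀Λ₀ : A₀ ⊆ Λ₀ := by
    intro a ha
    simp only [Finset.mem_filter, Finset.mem_univ, true_and, hA₀, hΛ₀] at ha ⊢
    exact hA ha
  -- the two embeddings are local isomorphisms at `Λ₀`
  have hadj₁ : ∀ a ∈ Λ₀, ∀ b : S, (zdGraph d).Adj (ι₁ a) (ι₁ b) ↔ Gs.Adj a b := fun a _ b => Iff.rfl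
  have hnb₁ : ∀ a ∈ Λ₀, ∀ y : Site d, (zdGraph d).Adj (ι₁ a) y → ∃ b : S, ι₁ b = y := by
    intro a ha y h
    have ha' : (a : Site d) ∈ box d M := by simpa [hΛ₀] using ha
    exact ⟨⟨y, mem_box_succ_of_zdGraph_adj (d := d) ha' h⟩, rfl⟩
  have hadj₂ : ∀ a ∈ Λ₀, ∀ b : S, (torusGraph d N).Adj (ι₂ a) (ι₂ b) ↔ Gs.Adj a b := by
    intro a _ b
    exact torusGraph_adj_proj_iff (M := M + 1) (by omega) a.2 b.2
  have hnb₂ : ∀ a ∈ Λ₀, ∀ y' : TorusSite d N, (torusGraph d N).Adj (ι₂ a) y' → ∃ b : S, ι₂ b = y' := by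
    intro a ha y' h
    have ha' : (a : Site d) ∈ box d M := by simpa [hΛ₀] using ha
    obtain ⟨-, y, rfl, hy⟩ := (torusGraph_adj_proj_left_iff N a.1 y').1 h
    exact ⟨⟨y, mem_box_succ_of_zdGraph_adj (d := d) ha' hy⟩, rfl⟩
  -- the chain of comparisons
  have hΛimg : Λ₀.map ι₂ ⊆ (Finset.univ : Finset (TorusSite d N)) := Finset.subset_univ _
  have hAimg : A₀.map ι₂ ⊆ Λ₀.map ι₂ := Finset.map_subset_map.2 hA₀Λ₀
  calc isingCorr (torusGraph d N) Finset.univ β 0 .free (A.image (Torus.proj N))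
      = isingCorr (torusGraph d N) Finset.univ β 0 .plus (A₀.map ι₂) := by
        rw [← hA₀map₂, isingCorr_univ_plus_eq_free]
    _ ≤ isingCorr (torusGraph d N) (Λ₀.map ι₂) β 0 .plus (A₀.map ι₂) :=
        isingCorr_plus_le_of_subset (torusGraph d N) hβ le_rfl hAimg hΛimg
    _ = isingCorr Gs Λ₀ β 0 .plus A₀ := isingCorr_plus_map ι₂ hadj₂ hnb₂ β 0 A₀
    _ = isingCorr (zdGraph d) (Λ₀.map ι₁) β 0 .plus (A₀.map ι₁) := (isingCorr_plus_map ι₁ hadj₁ hnb₁ β 0 A₀).symm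
    _ = isingCorr (zdGraph d) (box d M) β 0 .plus A := by rw [hΛ₀map, hA₀map]

/-- **Torus ≤ plus box for the two-point function**: for `β ≥ 0`, `x ≠ y` in `Λ_M` and `2M + 4 ≤ N`,
`⟨σ_{x̄}σ_{ȳ}⟩_{𝕋_N;β} ≤ ⟨σ_{\{x,y\}}⟩⁺_{Λ_M;β}`. [cite: FriedliVelenik2017, Exercise 3.12, p. 112] -/
theorem isingTorusTwoPoint_le_isingCorr_plus_box {β : ℝ} (hβ : 0 ≤ β) {M N : ℕ} [NeZero N]
    (hMN : 2 * M + 4 ≤ N) {x y : Site d} (hx : x ∈ box d M) (hy : y ∈ box d M) (hxy : x ≠ y) :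
    isingTorusTwoPoint d N β 0 (Torus.proj N x) (Torus.proj N y) ≤
      isingCorr (zdGraph d) (box d M) β 0 .plus {x, y} := by
  classical
  have hne : Torus.proj N x ≠ Torus.proj N y := fun h =>
    hxy (torusProj_injOn_box (by omega) hx hy h)
  have himg : ({x, y} : Finset (Site d)).image (Torus.proj N) = {Torus.proj N x, Torus.proj N y} := by
    simp [Finset.image_insert, Finset.image_singleton]
  have key := isingCorr_torus_le_isingCorr_plus_box (d := d) hβ hMN
    (A := {x, y}) (Finset.insert_subset hx (Finset.singleton_subset_iff.2 hy))
  rw [himg] at key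
  have hpair : isingTorusTwoPoint d N β 0 (Torus.proj N x) (Torus.proj N y) =
      isingCorr (torusGraph d N) Finset.univ β 0 .free {Torus.proj N x, Torus.proj N y} := by
    simp only [isingTorusTwoPoint, isingTwoPoint, isingCorr]
    congr 1
    funext σ
    rw [spinPair, spinProduct, Finset.prod_pair hne]
  rw [hpair]
  exact key

/-! ### Part 3. The sandwich and the limit -/

/-- **The periodic two-point function converges to the infinite-volume two-point function**
(Aizenman–Duminil-Copin 2021, Prop. 5.2, second item, for pairs and periodic boxes): for `β ≥ 0`,
zero field and `x ≠ y`, if the free and plus states agree on `σ_xσ_y`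
(`⟨σ_xσ_y⟩^∅_β = ⟨σ_xσ_y⟩⁺_β`, e.g. whenever `m*(β) = 0`), then for every `ε > 0` there is `N₀`
with `|⟨σ_{x̄}σ_{ȳ}⟩_{𝕋_N;β} - ⟨σ_xσ_y⟩⁺_β| ≤ ε` for all `N ≥ N₀`. Proof: the Griffiths sandwich
`⟨σ_xσ_y⟩^∅_{Λ_n} ≤ ⟨σ_{x̄}σ_{ȳ}⟩_{𝕋_N} ≤ ⟨σ_xσ_y⟩⁺_{Λ_n}` (`isingTwoPoint_free_box_le_torus_of_gks`,
`isingTorusTwoPoint_le_isingCorr_plus_box`) and the box limits of the free and plus states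
(`isingCorr_free_box_le_freeCorr`, `plusCorr_le_isingCorr_plus_box` with the convergence
`hasBoxLimit_isingCorr_free/plus_holds`). [cite: AizenmanDuminilCopinAnnals2021, arXiv:1912.07973 Prop. 5.2 (p. 17)] -/
theorem abs_isingTorusTwoPoint_sub_plusCorr_le {β : ℝ} (hβ : 0 ≤ β) {x y : Site d} (hxy : x ≠ y)
    (heq : freeCorr d β 0 {x, y} = plusCorr d β 0 {x, y}) {ε : ℝ} (hε : 0 < ε) :
    ∃ N₀ : ℕ, ∀ N : ℕ, N₀ ≤ N → ∀ [NeZero N],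
      |isingTorusTwoPoint d N β 0 (Torus.proj N x) (Torus.proj N y) - plusCorr d β 0 {x, y}| ≤ ε := by
  classical
  -- a box containing `x, y`
  obtain ⟨L₀, hL₀⟩ := exists_forall_subset_box d ({x, y} : Finset (Site d))
  have hxy₀ : ∀ n, L₀ ≤ n → x ∈ box d n ∧ y ∈ box d n := fun n hn =>
    ⟨hL₀ n hn (by simp), hL₀ n hn (by simp)⟩
  -- free boxes converge from below, plus boxes from above
  have hfree := hasBoxLimit_isingCorr_free_holds (d := d) hβ le_rfl ({x, y} : Finset (Site d))
  have hplus := hasBoxLimit_isingCorr_plus_holds (d := d) hβ le_rfl ({x, y} : Finset (Site d))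
  rw [HasBoxLimit, Metric.tendsto_atTop] at hfree hplus
  obtain ⟨n₁, hn₁⟩ := hfree ε hε
  obtain ⟨n₂, hn₂⟩ := hplus ε hε
  set n := max L₀ (max n₁ n₂) with hn
  have hnL₀ : L₀ ≤ n := le_max_left _ _
  obtain ⟨hxn, hyn⟩ := hxy₀ n hnL₀
  refine ⟨2 * n + 4, fun N hN _ => ?_⟩
  -- lower bound
  have hlow : isingTwoPoint (zdGraph d) (box d n) β 0 .free x y ≤
      isingTorusTwoPoint d N β 0 (Torus.proj N x) (Torus.proj N y) :=
    isingTwoPoint_free_box_le_torus_of_gks (fun G' _ Λ A B β h bc => GKSInequalities.gks_two_holds G')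
      hβ (by omega) hxn hyn
  have hup : isingTorusTwoPoint d N β 0 (Torus.proj N x) (Torus.proj N y) ≤
      isingCorr (zdGraph d) (box d n) β 0 .plus {x, y} :=
    isingTorusTwoPoint_le_isingCorr_plus_box hβ (by omega) hxn hyn hxy
  have hfreepair : isingTwoPoint (zdGraph d) (box d n) β 0 .free x y =
      isingCorr (zdGraph d) (box d n) β 0 .free {x, y} := by
    simp only [isingTwoPoint, isingCorr]
    congr 1
    funext σ
    rw [spinPair, spinProduct, Finset.prod_pair hxy]
  have h1 := hn₁ n (le_trans (le_max_left _ _) (le_max_right _ _))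
  have h2 := hn₂ n (le_trans (le_max_right _ _) (le_max_right _ _))
  rw [Real.dist_eq] at h1 h2
  rw [abs_le]
  constructor
  · have := (abs_lt.1 h1).1
    rw [heq] at this
    linarith [hfreepair ▸ hlow]
  · have := (abs_lt.1 h2).2
    linarith

/-- **Corollary (the case `m*(β) = 0`)**: for `β ≥ 0` with vanishing spontaneous magnetisation — all
`β < β_c`, and `β = β_c` when `d ≥ 3` — the periodic two-point function converges to the (unique)
infinite-volume one, `⟨σ_{x̄}σ_{ȳ}⟩_{𝕋_N;β} → ⟨σ_xσ_y⟩⁺_β = ⟨σ_xσ_y⟩^∅_β`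
(`freeCorr_eq_plusCorr_of_spontaneousMagnetization_eq_zero`, Lebowitz–Martin-Löf).
[cite: AizenmanDuminilCopinAnnals2021, arXiv:1912.07973 Prop. 5.2 (p. 17)] -/
theorem abs_isingTorusTwoPoint_sub_plusCorr_le_of_spontaneousMagnetization_eq_zero {β : ℝ} (hβ : 0 ≤ β)
    (hm : spontaneousMagnetization d β = 0) {x y : Site d} (hxy : x ≠ y) {ε : ℝ} (hε : 0 < ε) :
    ∃ N₀ : ℕ, ∀ N : ℕ, N₀ ≤ N → ∀ [NeZero N],
      |isingTorusTwoPoint d N β 0 (Torus.proj N x) (Torus.proj N y) - plusCorr d β 0 {x, y}| ≤ ε :=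
  abs_isingTorusTwoPoint_sub_plusCorr_le hβ hxy
    (freeCorr_eq_plusCorr_of_spontaneousMagnetization_eq_zero hβ hm _) hε

end Torus

end Literature.Probability.LatticeModels

end
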